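import Summits.RiemannHypothesis.RiemannHypothesis.Theorems.WeilTwoPrimeDeflM80XBase
import Literature.NumberTheory.LFunctions.WeilBlockRows
import Literature.NumberTheory.LFunctions.WeilBlockRowsPZ
import Summits.RiemannHypothesis.RiemannHypothesis.Theorems.WeilTwoPrimeDeflM80PDataDnE18
import HarnessLib

/-!
# Calibration certificate M80X: rows 84–88 of the even `D C = I` and rows 86–88 of the claim `D = Dn / Ls` for M80P's factored even inverse

`WeilCert.checkDCRow 0` (5 rows) and `WeilCert.checkDnRow` (3 rows, `weilCertDeflM80XDnE` / `weilCertDeflM80PLsE`) for certificate M80X, by `decide +kernel` (gen3 re-split: ≤ 6 DC rows per file for the gate's 600-s elaboration cap under the farm's load variance). Pure proof file.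
-/

set_option linter.dupNamespace false

noncomputable section

namespace Summit.RiemannHypothesis.RiemannHypothesis.Theorems.EvenWinsBeyondArch

open Literature.NumberTheory.LFunctions

set_option maxHeartbeats 0 in
/-- Kernel check of row 84 of the even `D C = I` (certificate M80X). [folklore] -/
theorem checkDCRow0_84_weilCertDeflM80X : weilCertDeflM80XBase.checkDCRow 0 84 = true := by
  decide +kernel

set_option maxHeartbeats 0 in
/-- Kernel check of row 85 of the even `D C = I` (certificate M80X). [folklore] -/
theorem checkDCRow0_85_weilCertDeflM80X : weilCertDeflM80XBase.checkDCRow 0 85 = true := by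
  decide +kernel

set_option maxHeartbeats 0 in
/-- Kernel check of row 86 of the even `D C = I` (certificate M80X). [folklore] -/
theorem checkDCRow0_86_weilCertDeflM80X : weilCertDeflM80XBase.checkDCRow 0 86 = true := by
  decide +kernel

set_option maxHeartbeats 0 in
/-- Kernel check of row 87 of the even `D C = I` (certificate M80X). [folklore] -/
theorem checkDCRow0_87_weilCertDeflM80X : weilCertDeflM80XBase.checkDCRow 0 87 = true := by
  decide +kernel

set_option maxHeartbeats 0 in
/-- Kernel check of row 88 of the even `D C = I` (certificate M80X). [folklore] -/
theorem checkDCRow0_88_weilCertDeflM80X : weilCertDeflM80XBase.checkDCRow 0 88 = true := by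
  decide +kernel

-- ===== factored even inverse `D = Dn / Ls`: rows 86–88 =====
set_option maxHeartbeats 0 in
/-- Row 86 of `DnE/LsE` is row 86 of the even `D` (certificate M80X). [folklore] -/
theorem checkDnRow0_86_weilCertDeflM80X : weilCertDeflM80XBase.checkDnRow weilCertDeflM80XDnE weilCertDeflM80PLsE 0 86 = true := by
  decide +kernel

set_option maxHeartbeats 0 in
/-- Row 87 of `DnE/LsE` is row 87 of the even `D` (certificate M80X). [folklore] -/
theorem checkDnRow0_87_weilCertDeflM80X : weilCertDeflM80XBase.checkDnRow weilCertDeflM80XDnE weilCertDeflM80PLsE 0 87 = true := by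
  decide +kernel

set_option maxHeartbeats 0 in
/-- Row 88 of `DnE/LsE` is row 88 of the even `D` (certificate M80X). [folklore] -/
theorem checkDnRow0_88_weilCertDeflM80X : weilCertDeflM80XBase.checkDnRow weilCertDeflM80XDnE weilCertDeflM80PLsE 0 88 = true := by
  decide +kernel

end Summit.RiemannHypothesis.RiemannHypothesis.Theorems.EvenWinsBeyondArch

end
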